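import Mathlib
import HarnessLib
import Summits.Ventures.LatticeQCDFlow.Exactness.SymmetricMetropolis
import Summits.Ventures.LatticeQCDFlow.Exactness.InvariantComposition
import Summits.Ventures.LatticeQCDFlow.Exactness.RefreshScan
import Summits.Ventures.LatticeQCDFlow.Exactness.CompactHaar
import Summits.Ventures.LatticeQCDFlow.Exactness.SphereSpreading
import Literature.MathematicalPhysics.QuantumFieldTheory.ContinuumLimitsYM2ConvolutionProofs

/-!
# Small kicks cover a connected compact group: some number of random-walk steps dominates a multiple of Haar measure

HONEST FRAMING: exact (Metropolis-corrected) sampling algorithms for lattice gauge theory;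
figures of merit are autocorrelation/cost numbers at stated couplings and volumes; no
continuum-physics claim.

Venture `LatticeQCDFlow` (cell pub-lqcd), topic `Exactness`, FANOUT row 9 (eng-latcore, the
engine `latflow.core`: the N-hit link Metropolis `U ← exp(X) U` of `updates.sweep_metropolis`,
`sun_2d.sweep_metropolis`, whose kicks `exp(X)` do NOT commute on `SU(N)`).  NEW WORK of the cell
over Mathlib (Haar measure, Urysohn's lemma, open subgroups of connected groups) and the tree
(`SymmetricMetropolis.lean`: `mulWalk`, `lintegral_mulWalk`; `InvariantComposition.lean`: `nHit`;
`RefreshScan.lean`: `comp_minorised`, `minorised_comp_left`; `CompactHaar.lean`: Haar of a compact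
group is right invariant; `SphereSpreading.lean`: `measure_smul_le_smul_of_le`; the Literature
group convolution `haarConv` with its continuity, used as a tool — no published statement is
invoked).  Nothing here is cited as a fact.  Printed counterparts, NAMED ONLY: Kawada–Itô 1940
(powers of an adapted measure on a connected compact group), Meyn–Tweedie 1993 ch. 16 (small sets).

THE GROUP-CONVOLUTION COVERING LEMMA that `U1MetropolisLinkErgodic.lean` names as the missing
input for `SU(2)`.  On `U(1)` the tree doubles box-uniform kicks explicitly
(`UniformKickDoubling.lean`); here `G` is any CONNECTED COMPACT second-countable group with its Haar
probability `μ`, and the statement is qualitative (some number of kicks, some constant):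
* §1 `mulWalk_apply`, **`smul_nHit_mulWalk_le`** — if the step law `ν` dominates `c · ρ` then
  `n` steps of `ν` dominate `c^n ×` `n` steps of `ρ`; `haar_invariant_mulWalk`;
  `nHit_mulWalk_minorised_of_le` — once `k` kicks dominate `δ ·` Haar, so do `n ≥ k` kicks.
* §2 (with the Literature group convolution `haarConv k f x = ∫ k(h) f(h⁻¹x) dμ(h)` of
  `QuantumLattice.HeatKernelGroupConvolutionProofs` and its convolution powers `(φ ⋆)^[n] φ` of
  `ContinuumLimitsYM2ConvolutionProofs` — continuity and non-negativity imported)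
  `haarConv_pos_mul` — `(f ⋆ g)(ab) > 0` when `f(a), g(b) > 0`, `f, g ≥ 0` continuous;
  **`haarConv_iterate_pos_of_mem_pow`** — the density `(φ ⋆)^[n] φ` of `n + 1` kicks of law `φμ`
  is positive on the set power `{φ > 0}^(n+1)`.
* §3 **`exists_pow_eq_univ`** — an open symmetric neighbourhood `W` of `1` in a connected compact
  group has a power `W^(N+1) = G` (`⋃ₙ Wⁿ` is an open, hence closed, subgroup; compactness).
* §4 **`withDensity_bind_mulWalk_withDensity`** (right invariance + Tonelli),
  **`map_withDensity_haarConv_iterate`** — `n + 1` kicks of law `φμ` from `u` have the law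
  `((φ ⋆)^[n] φ · μ) ∘ (·u)⁻¹`.
* §5 **`exists_nHit_mulWalk_minorised_of_density`** — if `ν ≥ c · φμ` for a continuous `φ ≥ 0`
  with `φ(1) > 0`, then SOME number `k` of `ν`-kicks dominates `δ ·` Haar from EVERY start
  (`δ > 0`); **`exists_nHit_mulWalk_minorised`** — the same for `ν ≥ c · μ|_V`, `V` any
  neighbourhood of `1` (Urysohn): what makes an N-hit Metropolis link update Doeblin.

NOT CLAIMED: any value of `k` or `δ` (compactness argument); non-compact or disconnected groups
(false there); the sweep over links (separate file).
-/

noncomputable section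

namespace Summit.Ventures.LatticeQCDFlow.Exactness

open MeasureTheory ProbabilityTheory Set Filter Topology Function
open Literature.MathematicalPhysics.QuantumFieldTheory (haarProbability continuous_haarConv_iterate haarConv_iterate_nonneg)
open Literature.MathematicalPhysics.QuantumLattice (haarConv haarConv_apply haarConv_eq_integral_mul_inv)
open scoped ENNReal Pointwise

/-! ## §1 The random-walk kernel: formula, monotonicity in the step law, powers -/

section Walk

variable {G : Type*} [Group G] [MeasurableSpace G] [MeasurableMul₂ G]

/-- `mulWalk ρ u` is the image of the step law under `X ↦ X * u`. -/
theorem mulWalk_apply (ρ : Measure G) [SFinite ρ] (u : G) : mulWalk ρ u = ρ.map (· * u) := by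
  ext s hs
  rw [← lintegral_indicator_one hs, lintegral_mulWalk ρ u (measurable_one.indicator hs),
    Measure.map_apply (measurable_mul_const u) hs, ← lintegral_indicator_one (measurable_mul_const u hs)]
  rfl

/-- **Monotone and homogeneous in the step law**: `c • ρ ≤ ν` gives `c • law(X u) ≤ law(Y u)`. -/
theorem smul_mulWalk_le {ρ ν : Measure G} [SFinite ρ] [SFinite ν] {c : ℝ≥0∞} (h : c • ρ ≤ ν) (u : G) :
    c • mulWalk ρ u ≤ mulWalk ν u := by
  rw [mulWalk_apply, mulWalk_apply, ← Measure.map_smul]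
  exact Measure.map_mono h (measurable_mul_const u)

/-- **Powers**: if one `ν`-kick dominates `c ×` one `ρ`-kick, `n` kicks dominate `c^n ×` `n` kicks. -/
theorem smul_nHit_mulWalk_le {ρ ν : Measure G} [SFinite ρ] [SFinite ν] {c : ℝ≥0∞} (h : c • ρ ≤ ν) :
    ∀ (n : ℕ) (u : G), c ^ n • nHit (mulWalk ρ) n u ≤ nHit (mulWalk ν) n u
  | 0, u => by simp
  | n + 1, u => by
      rw [nHit_succ, nHit_succ, pow_succ]
      exact comp_minorised (smul_nHit_mulWalk_le h n) (smul_mulWalk_le h) u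

/-- Kicking after a right translation is right-translating after the kick: `X·(Z u) = (X Z)·u`. -/
theorem bind_mulWalk_map_mul_right (ρ σ : Measure G) [SFinite ρ] [SFinite σ] (u : G) :
    (σ.map (· * u)).bind (mulWalk ρ) = (σ.bind (mulWalk ρ)).map (· * u) := by
  ext s hs
  have hsu : MeasurableSet ((· * u) ⁻¹' s) := measurable_mul_const u hs
  rw [Measure.bind_apply hs (Kernel.aemeasurable _),
    lintegral_map (Kernel.measurable_coe _ hs) (measurable_mul_const u),
    Measure.map_apply (measurable_mul_const u) hs, Measure.bind_apply hsu (Kernel.aemeasurable _)]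
  refine lintegral_congr fun y => ?_
  rw [mulWalk_apply, mulWalk_apply, Measure.map_apply (measurable_mul_const _) hs,
    Measure.map_apply (measurable_mul_const _) hsu]
  congr 1
  ext X
  simp only [mem_preimage, mul_assoc]

end Walk

section HaarWalk

variable {G : Type*} [TopologicalSpace G] [Group G] [IsTopologicalGroup G] [CompactSpace G]
  [MeasurableSpace G] [BorelSpace G] [SecondCountableTopology G]

/-- **Haar measure is invariant under any kick** `u ↦ X u`, `X ∼ ρ` (left invariance, Tonelli). -/
theorem haar_invariant_mulWalk (ρ : Measure G) [IsProbabilityMeasure ρ] :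
    Kernel.Invariant (mulWalk ρ) (haarProbability G) := by
  change (haarProbability G).bind ⇑(mulWalk ρ) = haarProbability G
  ext s hs
  rw [Measure.bind_apply hs (Kernel.aemeasurable _)]
  have h : ∀ u : G, mulWalk ρ u s = ∫⁻ X, s.indicator 1 (X * u) ∂ρ := fun u => by
    rw [← lintegral_indicator_one hs, lintegral_mulWalk _ u (measurable_one.indicator hs)]
  have hin : ∀ X : G, ∫⁻ u, s.indicator (1 : G → ℝ≥0∞) (X * u) ∂(haarProbability G) =
      haarProbability G s := fun X => by
    rw [show (fun u => s.indicator (1 : G → ℝ≥0∞) (X * u)) = fun u => ((X * ·) ⁻¹' s).indicator 1 u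
      from rfl, lintegral_indicator_one (measurable_const_mul X hs), measure_preimage_mul]
  simp_rw [h]
  rw [lintegral_lintegral_swap (show Measurable (fun q : G × G => s.indicator (1 : G → ℝ≥0∞)
    (q.2 * q.1)) from (measurable_one.indicator hs).comp (measurable_snd.mul measurable_fst)).aemeasurable]
  simp_rw [hin]
  rw [MeasureTheory.lintegral_const, measure_univ, mul_one]

/-- **Once `k` kicks dominate `δ ·` Haar from every start, so do `n ≥ k` kicks** (Haar is invariant). -/
theorem nHit_mulWalk_minorised_of_le (ρ : Measure G) [IsProbabilityMeasure ρ] {δ : ℝ≥0∞} {k n : ℕ}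
    (h : ∀ u : G, δ • haarProbability G ≤ nHit (mulWalk ρ) k u) (hn : k ≤ n) (u : G) :
    δ • haarProbability G ≤ nHit (mulWalk ρ) n u := by
  obtain ⟨e, rfl⟩ := Nat.exists_eq_add_of_le hn
  clear hn
  have hsplit : nHit (mulWalk ρ) (k + e) = nHit (mulWalk ρ) e ∘ₖ nHit (mulWalk ρ) k := by
    induction e with
    | zero => rw [Nat.add_zero, nHit_zero, Kernel.id_comp]
    | succ e ih => rw [Nat.add_succ, nHit_succ, nHit_succ, ih, Kernel.comp_assoc]
  rw [hsplit]
  have hmin := minorised_comp_left h (nHit (mulWalk ρ) e) u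
  rwa [(invariant_nHit (haar_invariant_mulWalk ρ) e).def] at hmin

end HaarWalk

/-! ## §2 Convolution powers of a continuous non-negative density: positivity on set powers -/

section Conv

variable {G : Type*} [TopologicalSpace G] [Group G] [IsTopologicalGroup G] [CompactSpace G]
  [MeasurableSpace G] [BorelSpace G]

/-- **Positivity of the group convolution at a product**: for continuous `f, g ≥ 0` with
`f(a) > 0`, `g(b) > 0`, `(f ⋆ g)(a b) = ∫ f(h) g(h⁻¹ab) dμ(h) > 0` (the integrand is positive at
`h = a`; Haar charges open sets).  The Literature `haarConv_pos` asks `f, g > 0` everywhere. -/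
theorem haarConv_pos_mul {f g : G → ℝ} (hf : Continuous f) (hg : Continuous g) (hf0 : 0 ≤ f) (hg0 : 0 ≤ g)
    {a b : G} (ha : 0 < f a) (hb : 0 < g b) : 0 < haarConv f g (a * b) := by
  rw [haarConv_apply]
  refine Continuous.integral_pos_of_hasCompactSupport_nonneg_nonzero (x := a)
    (hf.mul (hg.comp (continuous_inv.mul continuous_const))) (HasCompactSupport.of_compactSpace _)
    (fun h => mul_nonneg (hf0 _) (hg0 _)) ?_
  show f a * g (a⁻¹ * (a * b)) ≠ 0
  rw [inv_mul_cancel_left]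
  exact (mul_pos ha hb).ne'

omit [IsTopologicalGroup G] [MeasurableSpace G] [BorelSpace G] in
/-- A continuous everywhere-positive function on a compact space is bounded below by a positive constant. -/
theorem exists_pos_forall_le {h : G → ℝ} (hc : Continuous h) (hpos : ∀ x, 0 < h x) :
    ∃ m : ℝ, 0 < m ∧ ∀ x, m ≤ h x := by
  obtain ⟨x₀, -, hx₀⟩ := isCompact_univ.exists_isMinOn (univ_nonempty (α := G)) hc.continuousOn
  exact ⟨h x₀, hpos x₀, fun x => (isMinOn_iff.1 hx₀) x (mem_univ x)⟩

/-- **`n + 1` kicks with density `φ` reach the set power `{φ > 0}^(n+1) with positive density.** -/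
theorem haarConv_iterate_pos_of_mem_pow {φ : G → ℝ} (hφ : Continuous φ) (hφ0 : 0 ≤ φ) :
    ∀ (n : ℕ) {x : G}, x ∈ {y : G | 0 < φ y} ^ (n + 1) → 0 < ((haarConv φ)^[n] φ) x
  | 0, x, hx => by
      rw [zero_add, pow_one] at hx
      exact hx
  | n + 1, x, hx => by
      rw [pow_succ'] at hx
      obtain ⟨a, ha, b, hb, rfl⟩ := Set.mem_mul.1 hx
      rw [Function.iterate_succ_apply']
      exact haarConv_pos_mul hφ (continuous_haarConv_iterate hφ n) hφ0
        (fun y => haarConv_iterate_nonneg (fun z => hφ0 z) n y) ha (haarConv_iterate_pos_of_mem_pow hφ hφ0 n hb)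

end Conv

/-! ## §3 A neighbourhood of the identity generates a connected compact group in boundedly many steps -/

section Generate

variable {G : Type*} [TopologicalSpace G] [Group G] [IsTopologicalGroup G] [CompactSpace G]
  [ConnectedSpace G]

/-- **An open symmetric neighbourhood `W` of `1` has a power `W^(N+1) = G`.**  The union of the
powers is a subgroup containing a neighbourhood of `1`, hence open, hence closed, hence all of the
connected group; the powers increase (`1 ∈ W`) and are open, so compactness picks one. -/
theorem exists_pow_eq_univ {W : Set G} (hW : IsOpen W) (h1 : (1 : G) ∈ W) (hsymm : W⁻¹ = W) :
    ∃ N : ℕ, W ^ (N + 1) = univ := by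
  let H : Subgroup G :=
    { carrier := ⋃ n : ℕ, W ^ n
      one_mem' := mem_iUnion.2 ⟨0, by rw [pow_zero]; exact Set.one_mem_one⟩
      mul_mem' := by
        intro a b ha hb
        obtain ⟨m, ha⟩ := mem_iUnion.1 ha
        obtain ⟨n, hb⟩ := mem_iUnion.1 hb
        exact mem_iUnion.2 ⟨m + n, by rw [pow_add]; exact Set.mul_mem_mul ha hb⟩
      inv_mem' := by
        intro a ha
        obtain ⟨n, ha⟩ := mem_iUnion.1 ha
        refine mem_iUnion.2 ⟨n, ?_⟩
        have h := Set.inv_mem_inv.2 ha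
        rwa [← inv_pow, hsymm] at h }
  have hmem : (H : Set G) ∈ 𝓝 (1 : G) :=
    mem_of_superset (hW.mem_nhds h1) fun x hx => mem_iUnion.2 ⟨1, by rwa [pow_one]⟩
  have hopen : IsOpen (H : Set G) := Subgroup.isOpen_of_mem_nhds H hmem
  have huniv : (H : Set G) = univ :=
    IsClopen.eq_univ ⟨Subgroup.isClosed_of_isOpen H hopen, hopen⟩ ⟨1, H.one_mem⟩
  have hcover : (univ : Set G) ⊆ ⋃ n : ℕ, W ^ (n + 1) := by
    intro x _
    have hx : x ∈ (H : Set G) := by rw [huniv]; exact mem_univ x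
    obtain ⟨n, hn⟩ := mem_iUnion.1 hx
    exact mem_iUnion.2 ⟨n, Set.pow_subset_pow_right h1 (Nat.le_succ n) hn⟩
  have hopen' : ∀ n : ℕ, IsOpen (W ^ (n + 1)) := fun n => by
    rw [pow_succ]; exact hW.mul_left
  have hdir : Directed (· ⊆ ·) fun n : ℕ => W ^ (n + 1) :=
    Monotone.directed_le fun m n hmn => Set.pow_subset_pow_right h1 (Nat.succ_le_succ hmn)
  obtain ⟨N, hN⟩ := isCompact_univ.elim_directed_cover _ hopen' hcover hdir
  exact ⟨N, eq_univ_of_univ_subset hN⟩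

end Generate

/-! ## §4 The law of `n + 1` kicks with a continuous density -/

section Law

variable {G : Type*} [TopologicalSpace G] [Group G] [IsTopologicalGroup G] [CompactSpace G]
  [MeasurableSpace G] [BorelSpace G] [SecondCountableTopology G]

/-- **Start with law `ψμ`, kick with law `φμ`: the result has law `(∫ φ(x y⁻¹) ψ(y) dμ(y)) · μ`**
(right invariance of Haar measure moves the kick into the density; Tonelli). -/
theorem withDensity_bind_mulWalk_withDensity {φ ψ : G → ℝ≥0∞} (hφ : Measurable φ) (hψ : Measurable ψ) :
    ((haarProbability G).withDensity ψ).bind (mulWalk ((haarProbability G).withDensity φ)) =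
      (haarProbability G).withDensity fun x => ∫⁻ y, φ (x * y⁻¹) * ψ y ∂(haarProbability G) := by
  set μ := haarProbability G
  ext s hs
  have hker : Measurable fun y : G => mulWalk (μ.withDensity φ) y s := Kernel.measurable_coe _ hs
  rw [Measure.bind_apply hs (Kernel.aemeasurable _), lintegral_withDensity_eq_lintegral_mul _ hψ hker,
    withDensity_apply _ hs]
  -- the kick from `y`, as an integral over the target set
  have hkick : ∀ y : G, mulWalk (μ.withDensity φ) y s = ∫⁻ x in s, φ (x * y⁻¹) ∂μ := fun y => by
    rw [mulWalk_apply, Measure.map_apply (measurable_mul_const y) hs,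
      withDensity_apply _ (measurable_mul_const y hs), ← lintegral_indicator (measurable_mul_const y hs),
      ← lintegral_indicator hs,
      ← lintegral_mul_right_eq_self (fun x => s.indicator (fun x => φ (x * y⁻¹)) x) y]
    refine lintegral_congr fun x => ?_
    by_cases hx : x * y ∈ s
    · rw [indicator_of_mem (show x ∈ (· * y) ⁻¹' s from hx), indicator_of_mem hx, mul_inv_cancel_right]
    · rw [indicator_of_notMem (show x ∉ (· * y) ⁻¹' s from hx), indicator_of_notMem hx]
  simp only [Pi.mul_apply, hkick]
  have hF : Measurable (uncurry fun (y x : G) => φ (x * y⁻¹) * ψ y) :=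
    (hφ.comp (measurable_snd.mul measurable_fst.inv)).mul (hψ.comp measurable_fst)
  calc ∫⁻ y, ψ y * ∫⁻ x in s, φ (x * y⁻¹) ∂μ ∂μ
      = ∫⁻ y, ∫⁻ x in s, φ (x * y⁻¹) * ψ y ∂μ ∂μ := by
        refine lintegral_congr fun y => ?_
        have hmeas : Measurable fun x => φ (x * y⁻¹) := hφ.comp (measurable_mul_const y⁻¹)
        rw [lintegral_mul_const _ hmeas, mul_comm]
    _ = ∫⁻ x in s, ∫⁻ y, φ (x * y⁻¹) * ψ y ∂μ ∂μ :=
        lintegral_lintegral_swap (hF.aemeasurable)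

omit [SecondCountableTopology G] in
/-- `ofReal (f ⋆ g)(x) = ∫⁻ ofReal f(x y⁻¹) · ofReal g(y) dμ(y)` (via `haarConv_eq_integral_mul_inv`). -/
theorem ofReal_haarConv {f g : G → ℝ} (hf : Continuous f) (hg : Continuous g) (hf0 : 0 ≤ f) (hg0 : 0 ≤ g)
    (x : G) : ENNReal.ofReal (haarConv f g x) =
      ∫⁻ y, ENNReal.ofReal (f (x * y⁻¹)) * ENNReal.ofReal (g y) ∂(haarProbability G) := by
  have hc : Continuous fun y => f (x * y⁻¹) * g y := (hf.comp (continuous_const.mul continuous_inv)).mul hg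
  rw [haarConv_eq_integral_mul_inv, ofReal_integral_eq_lintegral_ofReal (hc.integrable_of_hasCompactSupport
    (HasCompactSupport.of_compactSpace _)) (Eventually.of_forall fun y => mul_nonneg (hf0 _) (hg0 _))]
  refine lintegral_congr fun y => ?_
  rw [ENNReal.ofReal_mul (hf0 _)]

/-- **The law of `n + 1` kicks of law `φ · μ` from `u` is `((φ ⋆)^[n] φ · μ) ∘ (·u)⁻¹`.** -/
theorem map_withDensity_haarConv_iterate {φ : G → ℝ} (hφ : Continuous φ) (hφ0 : 0 ≤ φ) :
    ∀ (n : ℕ) (u : G),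
      ((haarProbability G).withDensity fun x => ENNReal.ofReal (((haarConv φ)^[n] φ) x)).map (· * u) =
        nHit (mulWalk ((haarProbability G).withDensity fun x => ENNReal.ofReal (φ x))) (n + 1) u
  | 0, u => by
      rw [zero_add, nHit_succ, nHit_zero, Kernel.comp_id, mulWalk_apply]
      rfl
  | n + 1, u => by
      rw [nHit_succ, Kernel.comp_apply, ← map_withDensity_haarConv_iterate hφ hφ0 n u,
        bind_mulWalk_map_mul_right,
        withDensity_bind_mulWalk_withDensity hφ.measurable.ennreal_ofReal
          (continuous_haarConv_iterate hφ n).measurable.ennreal_ofReal]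
      congr 1
      refine withDensity_congr_ae (Eventually.of_forall fun x => ?_)
      show ENNReal.ofReal (((haarConv φ)^[n + 1] φ) x) = _
      rw [Function.iterate_succ_apply']
      exact ofReal_haarConv hφ (continuous_haarConv_iterate hφ n) hφ0
        (fun y => haarConv_iterate_nonneg (fun z => hφ0 z) n y) x

end Law

/-! ## §5 The covering theorem -/

section Cover

variable {G : Type*} [TopologicalSpace G] [Group G] [IsTopologicalGroup G] [CompactSpace G]
  [ConnectedSpace G] [MeasurableSpace G] [BorelSpace G] [SecondCountableTopology G]

/-- **SMALL KICKS COVER A CONNECTED COMPACT GROUP (density form).**  If the step law `ν` dominates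
`c · φμ` (`c ≠ 0`) for a continuous `φ ≥ 0` with `φ(1) > 0`, then for some number `k` of kicks and
some `δ > 0`, `(K^k)(u, ·) ≥ δ · Haar` from EVERY `u ∈ G`, `K = mulWalk ν`. -/
theorem exists_nHit_mulWalk_minorised_of_density {ν : Measure G} [SFinite ν] {φ : G → ℝ}
    (hφ : Continuous φ) (hφ0 : 0 ≤ φ) (hφ1 : 0 < φ 1) {c : ℝ≥0∞} (hc : c ≠ 0)
    (hν : c • (haarProbability G).withDensity (fun x => ENNReal.ofReal (φ x)) ≤ ν) :
    ∃ k : ℕ, ∃ δ : ℝ≥0∞, 0 < δ ∧ ∀ u : G, δ • haarProbability G ≤ nHit (mulWalk ν) k u := by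
  set μ := haarProbability G
  -- symmetrise the density
  set ψ : G → ℝ := fun x => min (φ x) (φ x⁻¹) with hψ
  have hψc : Continuous ψ := hφ.min (hφ.comp continuous_inv)
  have hφ0' : ∀ x, (0 : ℝ) ≤ φ x := fun x => hφ0 x
  have hψ0 : 0 ≤ ψ := fun x => le_min (hφ0' x) (hφ0' x⁻¹)
  have hψ1 : 0 < ψ 1 := by
    show 0 < min (φ 1) (φ 1⁻¹)
    rw [inv_one, min_self]
    exact hφ1
  have hψφ : ∀ x, ψ x ≤ φ x := fun x => min_le_left _ _
  have hψsymm : ∀ x, ψ x⁻¹ = ψ x := fun x => by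
    show min (φ x⁻¹) (φ x⁻¹⁻¹) = min (φ x) (φ x⁻¹)
    rw [inv_inv, min_comm]
  -- the open symmetric neighbourhood `W = {ψ > 0}` and its covering power
  set W : Set G := {x | 0 < ψ x} with hW
  have hWo : IsOpen W := isOpen_lt continuous_const hψc
  have hW1 : (1 : G) ∈ W := hψ1
  have hWsymm : W⁻¹ = W := by
    ext x
    simp only [Set.mem_inv, hW, mem_setOf_eq, hψsymm]
  obtain ⟨N, hN⟩ := exists_pow_eq_univ hWo hW1 hWsymm
  -- the density of `N + 1` kicks is continuous and positive everywhere, hence `≥ m > 0`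
  have hpos : ∀ x, 0 < ((haarConv ψ)^[N] ψ) x := fun x =>
    haarConv_iterate_pos_of_mem_pow hψc hψ0 N (by rw [hN]; exact mem_univ x)
  obtain ⟨m, hm0, hm⟩ := exists_pos_forall_le (continuous_haarConv_iterate hψc N) hpos
  -- `ν` dominates `c · ψμ`
  have hνψ : c • μ.withDensity (fun x => ENNReal.ofReal (ψ x)) ≤ ν := by
    refine le_trans (measure_smul_le_smul_of_le (withDensity_mono
      (Eventually.of_forall fun x => ENNReal.ofReal_le_ofReal (hψφ x))) c) ?_
    exact hν
  have hm0' : ENNReal.ofReal m ≠ 0 := by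
    rw [Ne, ENNReal.ofReal_eq_zero, not_le]; exact hm0
  refine ⟨N + 1, c ^ (N + 1) * ENNReal.ofReal m, ENNReal.mul_pos (pow_ne_zero _ hc) hm0', fun u => ?_⟩
  have hdens : ENNReal.ofReal m • μ ≤ μ.withDensity (fun x => ENNReal.ofReal (((haarConv ψ)^[N] ψ) x)) := by
    rw [← withDensity_const]
    exact withDensity_mono (Eventually.of_forall fun x => ENNReal.ofReal_le_ofReal (hm x))
  have hwalk : ENNReal.ofReal m • μ ≤
      nHit (mulWalk (μ.withDensity fun x => ENNReal.ofReal (ψ x))) (N + 1) u := by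
    rw [← map_withDensity_haarConv_iterate hψc hψ0 N u]
    have h := Measure.map_mono hdens (measurable_mul_const u)
    rwa [Measure.map_smul, map_mul_right_eq_self] at h
  calc (c ^ (N + 1) * ENNReal.ofReal m) • μ = c ^ (N + 1) • (ENNReal.ofReal m • μ) := by rw [mul_smul]
    _ ≤ c ^ (N + 1) • nHit (mulWalk (μ.withDensity fun x => ENNReal.ofReal (ψ x))) (N + 1) u :=
        measure_smul_le_smul_of_le hwalk _
    _ ≤ nHit (mulWalk ν) (N + 1) u := smul_nHit_mulWalk_le hνψ (N + 1) u

omit [ConnectedSpace G] [SecondCountableTopology G] in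
/-- A continuous `φ : G → [0, 1]` vanishing off an open `O` has `φ · μ ≤ μ|_O`. -/
theorem withDensity_ofReal_le_restrict {φ : G → ℝ} {O : Set G} (hO : MeasurableSet O)
    (hφ1 : ∀ x, φ x ≤ 1) (hφO : ∀ x, x ∉ O → φ x = 0) :
    (haarProbability G).withDensity (fun x => ENNReal.ofReal (φ x)) ≤ (haarProbability G).restrict O := by
  rw [← withDensity_indicator_one hO]
  refine withDensity_mono (Eventually.of_forall fun x => ?_)
  show ENNReal.ofReal (φ x) ≤ O.indicator 1 x
  by_cases hx : x ∈ O
  · rw [indicator_of_mem hx, Pi.one_apply]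
    exact ENNReal.ofReal_le_one.2 (hφ1 x)
  · rw [indicator_of_notMem hx, hφO x hx, ENNReal.ofReal_zero]

/-- **SMALL KICKS COVER A CONNECTED COMPACT GROUP.**  If the step law `ν` dominates `c ·` Haar
measure on some neighbourhood `V` of the identity (`c ≠ 0`), then for some number `k` of kicks and
some `δ > 0`, `(K^k)(u, ·) ≥ δ · Haar` from EVERY `u ∈ G`, `K = mulWalk ν`: the hypothesis of the
Doeblin certificate for the N-hit Metropolis link update with a pinched weight. -/
theorem exists_nHit_mulWalk_minorised {ν : Measure G} [SFinite ν] {V : Set G} (hV : V ∈ 𝓝 (1 : G))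
    {c : ℝ≥0∞} (hc : c ≠ 0) (hν : c • (haarProbability G).restrict V ≤ ν) :
    ∃ k : ℕ, ∃ δ : ℝ≥0∞, 0 < δ ∧ ∀ u : G, δ • haarProbability G ≤ nHit (mulWalk ν) k u := by
  obtain ⟨O, hOV, hO, h1O⟩ := mem_nhds_iff.1 hV
  obtain ⟨f, hf1, hf0, -, hf01⟩ := exists_continuous_one_zero_of_isCompact
    (isCompact_singleton (x := (1 : G))) hO.isClosed_compl
    (disjoint_compl_right_iff_subset.2 (singleton_subset_iff.2 h1O))
  have hφ1 : 0 < f 1 := by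
    rw [hf1 (mem_singleton 1), Pi.one_apply]; exact one_pos
  refine exists_nHit_mulWalk_minorised_of_density f.continuous (fun x => (hf01 x).1) hφ1 hc
    (le_trans (measure_smul_le_smul_of_le ?_ c) hν)
  exact (withDensity_ofReal_le_restrict hO.measurableSet (fun x => (hf01 x).2)
    (fun x hx => hf0 (mem_compl hx))).trans (Measure.restrict_mono hOV le_rfl)

end Cover

end Summit.Ventures.LatticeQCDFlow.Exactness
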